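import Mathlib
import Literature.Probability.LatticeModels.ThermodynamicLimit
import Literature.Probability.LatticeModels.SharpnessProofs
import HarnessLib

/-!
# Helpers (IV) for stub `stub_levyContinuityTransfer` of line `diffusive-branch-is-nonsaturation`
(crux `PrecisionLaplacian.DirectCorrelationStableTail`, item stmt-CriticalPhenomena-4799)

**Lévy's continuity theorem, transferred to finite measures on `ℝ³ = Fin 3 → ℝ`.**

* `levyCT_levy_transfer` (registered helper sub-goal `stub_levyContinuityTransfer_auxLevyTransfer`):
  if `μₙ, μ` are finite measures on `Fin 3 → ℝ`, `μ ≠ 0`, and the cosine and sine transforms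
  `∫ cos(ξ·y) dμₙ`, `∫ sin(ξ·y) dμₙ` converge to those of `μ` for every `ξ`, then
  `∫ φ dμₙ → ∫ φ dμ` for every bounded continuous `φ`.  Proof: push forward to
  `EuclideanSpace ℝ (Fin 3)` (where Mathlib's `charFun` lives; `levyCT_charFun_map_toLp`), normalise
  to probability measures (`FiniteMeasure.normalize`; the masses converge by the hypothesis at
  `ξ = 0`), apply Mathlib's **Lévy convergence theorem**
  `MeasureTheory.ProbabilityMeasure.tendsto_of_tendsto_charFun` and
  `ProbabilityMeasure.tendsto_iff_forall_integral_tendsto`, and undo the normalisation.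
* Bookkeeping for the two kinds of measures met in the stub: countable sums of weighted Dirac
  masses (`levyCT_isFiniteMeasure_sum_dirac`, `levyCT_integral_sum_dirac`) and measures with an
  integrable density (`levyCT_isFiniteMeasure_withDensity`, `levyCT_integral_withDensity`,
  `levyCT_withDensity_ne_zero`).
* `levyCT_test_function`: a compactly supported continuous `f` vanishing near `0` is `g · h` with
  `g(y) = 1 - e^{-|y|₂²/2}` and `h = f/g` bounded continuous.

All statements are folklore (P. Lévy's continuity theorem, e.g. P. Billingsley, *Probability and
Measure* (1995), Thm. 26.3 and §29); no definitions are introduced.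
-/

noncomputable section

namespace Summit.CriticalPhenomena.Ising3DConformalLimit.Cruxes.DirectCorrelationStableTail.DiffusiveBranchIsNonsaturation

open MeasureTheory Filter Topology
open scoped BigOperators
open Literature.Probability.LatticeModels

/-- A continuous function bounded by `B` is integrable against a finite measure. [folklore] -/
theorem levyCT_integrable_of_bounded (μ : Measure (Fin 3 → ℝ)) [IsFiniteMeasure μ]
    (f : (Fin 3 → ℝ) → ℝ) (hf : Continuous f) (B : ℝ) (hB : ∀ y, |f y| ≤ B) :
    Integrable f μ :=
  (integrable_const B).mono' hf.aestronglyMeasurable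
    (ae_of_all _ fun y => by simpa [Real.norm_eq_abs] using hB y)

/-- The characteristic function of the push-forward of a finite measure on `Fin 3 → ℝ` to
`EuclideanSpace ℝ (Fin 3)`, in coordinates: `∫ cos(t·y) dμ + i ∫ sin(t·y) dμ`. [folklore] -/
theorem levyCT_charFun_map_toLp (μ : Measure (Fin 3 → ℝ)) [IsFiniteMeasure μ]
    (t : EuclideanSpace ℝ (Fin 3)) :
    charFun (μ.map (WithLp.toLp 2)) t =
      ((∫ y, Real.cos (∑ j, t j * y j) ∂μ : ℝ) : ℂ) +
        ((∫ y, Real.sin (∑ j, t j * y j) ∂μ : ℝ) : ℂ) * Complex.I := by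
  rw [charFun_apply, integral_map (WithLp.measurable_toLp 2 _).aemeasurable (by fun_prop)]
  have hinner : ∀ y : Fin 3 → ℝ, (inner ℝ (WithLp.toLp 2 y) t : ℝ) = ∑ j, t j * y j := by
    intro y
    simp [PiLp.inner_apply, mul_comm]
  simp_rw [hinner]
  have h1 : ∀ y : Fin 3 → ℝ, Complex.exp (((∑ j, t j * y j : ℝ) : ℂ) * Complex.I) =
      ((Real.cos (∑ j, t j * y j) : ℝ) : ℂ) +
        ((Real.sin (∑ j, t j * y j) : ℝ) : ℂ) * Complex.I := by
    intro y
    rw [Complex.exp_mul_I, Complex.ofReal_cos, Complex.ofReal_sin]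
  simp_rw [h1]
  have hc : Integrable (fun y : Fin 3 → ℝ => ((Real.cos (∑ j, t j * y j) : ℝ) : ℂ)) μ :=
    (levyCT_integrable_of_bounded μ _ (by fun_prop) 1 (fun y => Real.abs_cos_le_one _)).ofReal
  have hs : Integrable (fun y : Fin 3 → ℝ =>
      ((Real.sin (∑ j, t j * y j) : ℝ) : ℂ) * Complex.I) μ :=
    (levyCT_integrable_of_bounded μ _ (by fun_prop) 1
      (fun y => Real.abs_sin_le_one _)).ofReal.mul_const _
  rw [integral_add hc hs, integral_mul_const, integral_complex_ofReal, integral_complex_ofReal]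


/-- The real mass of a finite measure on Euclidean space whose underlying measure is the
push-forward of `μ` is the real mass of `μ`. [folklore] -/
theorem levyCT_mass_map_toLp (μ : Measure (Fin 3 → ℝ)) [IsFiniteMeasure μ]
    (ρ : FiniteMeasure (EuclideanSpace ℝ (Fin 3)))
    (hρ : (ρ : Measure (EuclideanSpace ℝ (Fin 3))) = μ.map (WithLp.toLp 2)) :
    (ρ.mass : ℝ) = μ.real Set.univ := by
  rw [← ENNReal.coe_toReal, FiniteMeasure.ennreal_mass, hρ,
    Measure.map_apply (WithLp.measurable_toLp 2 _) MeasurableSet.univ, Set.preimage_univ,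
    measureReal_def]

/-- **Lévy continuity transfer on `ℝ³` (finite measures).**  Let `μₙ, μ` be finite measures on
`Fin 3 → ℝ`, `μ ≠ 0`, such that the cosine and sine transforms of `μₙ` converge pointwise to
those of `μ`.  Then `∫ φ dμₙ → ∫ φ dμ` for every bounded continuous `φ`.
Proof: push forward to `EuclideanSpace ℝ (Fin 3)`, normalise to probability measures (the
masses converge to the positive mass of `μ`, by the hypothesis at frequency `0`), apply
Mathlib's Lévy convergence theorem `ProbabilityMeasure.tendsto_of_tendsto_charFun`, and read
off the convergence of integrals of bounded continuous functions
(`ProbabilityMeasure.tendsto_iff_forall_integral_tendsto`). [folklore] -/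
theorem levyCT_levy_transfer (μs : ℕ → Measure (Fin 3 → ℝ)) (μ : Measure (Fin 3 → ℝ))
    [∀ n, IsFiniteMeasure (μs n)] [IsFiniteMeasure μ] (hne : μ ≠ 0)
    (hcos : ∀ ξ : Fin 3 → ℝ,
      Tendsto (fun n => ∫ y, Real.cos (∑ j, ξ j * y j) ∂(μs n)) atTop
        (𝓝 (∫ y, Real.cos (∑ j, ξ j * y j) ∂μ)))
    (hsin : ∀ ξ : Fin 3 → ℝ,
      Tendsto (fun n => ∫ y, Real.sin (∑ j, ξ j * y j) ∂(μs n)) atTop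
        (𝓝 (∫ y, Real.sin (∑ j, ξ j * y j) ∂μ)))
    (φ : (Fin 3 → ℝ) → ℝ) (hφ : Continuous φ) (B : ℝ) (hB : ∀ y, |φ y| ≤ B) :
    Tendsto (fun n => ∫ y, φ y ∂(μs n)) atTop (𝓝 (∫ y, φ y ∂μ)) := by
  have hT : Measurable (WithLp.toLp 2 : (Fin 3 → ℝ) → EuclideanSpace ℝ (Fin 3)) :=
    WithLp.measurable_toLp 2 _
  -- the push-forwards, as finite measures on Euclidean space
  set ν : ℕ → FiniteMeasure (EuclideanSpace ℝ (Fin 3)) :=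
    fun n => ⟨(μs n).map (WithLp.toLp 2), inferInstance⟩ with hν
  set ν₀ : FiniteMeasure (EuclideanSpace ℝ (Fin 3)) := ⟨μ.map (WithLp.toLp 2), inferInstance⟩
    with hν₀
  have hmass : ∀ n, ((ν n).mass : ℝ) = (μs n).real Set.univ := fun n =>
    levyCT_mass_map_toLp (μs n) (ν n) rfl
  have hmass₀ : (ν₀.mass : ℝ) = μ.real Set.univ := levyCT_mass_map_toLp μ ν₀ rfl
  have hμpos : 0 < μ.real Set.univ := by
    rw [measureReal_def, ENNReal.toReal_pos_iff]
    exact ⟨MeasureTheory.Measure.measure_univ_pos.2 hne, measure_lt_top _ _⟩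
  have hν₀ne : ν₀ ≠ 0 := by
    rw [← FiniteMeasure.mass_nonzero_iff]
    intro h
    have h' : ((ν₀.mass : ℝ)) = 0 := by rw [h, NNReal.coe_zero]
    linarith [hmass₀.symm.trans h']
  -- convergence of the masses (the hypothesis at frequency `0`)
  have hmass_t : Tendsto (fun n => (μs n).real Set.univ) atTop (𝓝 (μ.real Set.univ)) := by
    simpa using hcos 0
  have hev : ∀ᶠ n in atTop, ν n ≠ 0 := by
    filter_upwards [hmass_t.eventually_const_lt hμpos] with n hn h0
    rw [← hmass n, ← FiniteMeasure.mass_zero_iff] at *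
    rw [h0, NNReal.coe_zero] at hn
    exact lt_irrefl _ hn
  -- normalised probability measures
  set P : ℕ → ProbabilityMeasure (EuclideanSpace ℝ (Fin 3)) := fun n => (ν n).normalize with hP
  set P₀ : ProbabilityMeasure (EuclideanSpace ℝ (Fin 3)) := ν₀.normalize with hP₀
  -- characteristic functions of the push-forwards converge
  have hνchar : ∀ t : EuclideanSpace ℝ (Fin 3),
      Tendsto (fun n => charFun (ν n : Measure (EuclideanSpace ℝ (Fin 3))) t) atTop
        (𝓝 (charFun (ν₀ : Measure (EuclideanSpace ℝ (Fin 3))) t)) := by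
    intro t
    have e1 : ∀ n, charFun (ν n : Measure (EuclideanSpace ℝ (Fin 3))) t = _ :=
      fun n => levyCT_charFun_map_toLp (μs n) t
    simp_rw [e1, hν₀, FiniteMeasure.toMeasure_mk, levyCT_charFun_map_toLp μ t]
    exact ((hcos _).ofReal).add (((hsin _).ofReal).mul_const _)
  have hmassN : Tendsto (fun n => (ν n).mass⁻¹) atTop (𝓝 ν₀.mass⁻¹) := by
    have h1 : Tendsto (fun n => ((ν n).mass : ℝ)) atTop (𝓝 (ν₀.mass : ℝ)) := by
      simp_rw [hmass, hmass₀]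
      exact hmass_t
    exact (NNReal.tendsto_coe.1 h1).inv₀ ((FiniteMeasure.mass_nonzero_iff _).2 hν₀ne)
  have hchar : ∀ t : EuclideanSpace ℝ (Fin 3),
      Tendsto (fun n => charFun (P n : Measure (EuclideanSpace ℝ (Fin 3))) t) atTop
        (𝓝 (charFun (P₀ : Measure (EuclideanSpace ℝ (Fin 3))) t)) := by
    intro t
    have key : ∀ ρ : FiniteMeasure (EuclideanSpace ℝ (Fin 3)), ρ ≠ 0 →
        charFun (ρ.normalize : Measure (EuclideanSpace ℝ (Fin 3))) t =
          ρ.mass⁻¹ • charFun (ρ : Measure (EuclideanSpace ℝ (Fin 3))) t := by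
      intro ρ hρ
      rw [ρ.toMeasure_normalize_eq_of_nonzero hρ, charFun_apply, charFun_apply,
        integral_smul_nnreal_measure]
    have hlim : charFun (P₀ : Measure (EuclideanSpace ℝ (Fin 3))) t =
        ν₀.mass⁻¹ • charFun (ν₀ : Measure (EuclideanSpace ℝ (Fin 3))) t := key ν₀ hν₀ne
    rw [hlim]
    refine Tendsto.congr' ?_ (hmassN.smul (hνchar t))
    filter_upwards [hev] with n hn
    exact (key (ν n) hn).symm
  have hPt : Tendsto P atTop (𝓝 P₀) := ProbabilityMeasure.tendsto_of_tendsto_charFun hchar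
  -- the bounded continuous test function on Euclidean space
  set φE : BoundedContinuousFunction (EuclideanSpace ℝ (Fin 3)) ℝ :=
    BoundedContinuousFunction.ofNormedAddCommGroup (fun u => φ (WithLp.ofLp u))
      (hφ.comp (PiLp.continuous_ofLp 2 _)) B
      (fun u => by simpa [Real.norm_eq_abs] using hB (WithLp.ofLp u)) with hφE
  have hintP := (ProbabilityMeasure.tendsto_iff_forall_integral_tendsto.1 hPt) φE
  have hback : ∀ (ρ : Measure (Fin 3 → ℝ)) [IsFiniteMeasure ρ],
      ∫ u, φE u ∂(ρ.map (WithLp.toLp 2)) = ∫ y, φ y ∂ρ := by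
    intro ρ _
    rw [integral_map hT.aemeasurable φE.continuous.aestronglyMeasurable]
    rfl
  have key2 : ∀ (ρ : Measure (Fin 3 → ℝ)) [IsFiniteMeasure ρ]
      (ρE : FiniteMeasure (EuclideanSpace ℝ (Fin 3))),
      (ρE : Measure (EuclideanSpace ℝ (Fin 3))) = ρ.map (WithLp.toLp 2) → ρE ≠ 0 →
      ∫ y, φ y ∂ρ = (ρE.mass : ℝ) *
        ∫ u, φE u ∂(ρE.normalize : Measure (EuclideanSpace ℝ (Fin 3))) := by
    intro ρ _ ρE hρE hρ0
    have hm0 : ρE.mass ≠ 0 := (FiniteMeasure.mass_nonzero_iff _).2 hρ0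
    rw [FiniteMeasure.toMeasure_normalize_eq_of_nonzero _ hρ0, integral_smul_nnreal_measure,
      hρE, hback ρ, NNReal.smul_def, smul_eq_mul, ← mul_assoc,
      NNReal.coe_inv, mul_inv_cancel₀ (NNReal.coe_ne_zero.2 hm0), one_mul]
  have hlim_eq : ∫ y, φ y ∂μ = (ν₀.mass : ℝ) *
      ∫ u, φE u ∂(P₀ : Measure (EuclideanSpace ℝ (Fin 3))) := key2 μ ν₀ rfl hν₀ne
  rw [hlim_eq]
  have hmassR : Tendsto (fun n => ((ν n).mass : ℝ)) atTop (𝓝 (ν₀.mass : ℝ)) := by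
    simp_rw [hmass, hmass₀]
    exact hmass_t
  refine Tendsto.congr' ?_ (hmassR.mul hintP)
  filter_upwards [hev] with n hn
  exact (key2 (μs n) (ν n) rfl hn).symm


/-! ### Lattice measures: countable sums of weighted Dirac masses -/

open Literature.Probability.LatticeModels in
/-- A countable sum of weighted Dirac masses with summable nonnegative weights is a finite
measure. [folklore] -/
theorem levyCT_isFiniteMeasure_sum_dirac (w : Site 3 → ℝ) (hw0 : ∀ x, 0 ≤ w x) (hw : Summable w)
    (p : Site 3 → (Fin 3 → ℝ)) :
    IsFiniteMeasure (Measure.sum fun x : Site 3 => ENNReal.ofReal (w x) • Measure.dirac (p x)) := by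
  refine ⟨?_⟩
  rw [Measure.sum_apply _ MeasurableSet.univ]
  simp only [Measure.smul_apply, measure_univ, smul_eq_mul, mul_one]
  rw [← ENNReal.ofReal_tsum_of_nonneg hw0 hw]
  exact ENNReal.ofReal_lt_top

open Literature.Probability.LatticeModels in
/-- Integration of a bounded continuous function against a countable sum of weighted Dirac
masses: `∫ φ d(∑ₓ wₓ δ_{pₓ}) = ∑ₓ wₓ φ(pₓ)`. [folklore] -/
theorem levyCT_integral_sum_dirac (w : Site 3 → ℝ) (hw0 : ∀ x, 0 ≤ w x) (hw : Summable w)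
    (p : Site 3 → (Fin 3 → ℝ)) (φ : (Fin 3 → ℝ) → ℝ) (hφ : Continuous φ) (B : ℝ)
    (hB : ∀ y, |φ y| ≤ B) :
    ∫ y, φ y ∂(Measure.sum fun x : Site 3 => ENNReal.ofReal (w x) • Measure.dirac (p x)) =
      ∑' x, w x * φ (p x) := by
  haveI := levyCT_isFiniteMeasure_sum_dirac w hw0 hw p
  rw [integral_sum_measure (levyCT_integrable_of_bounded _ φ hφ B hB)]
  refine tsum_congr fun x => ?_
  rw [integral_smul_measure, integral_dirac, ENNReal.toReal_ofReal (hw0 x), smul_eq_mul]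

/-! ### Absolutely continuous finite measures -/

/-- A nonnegative integrable density defines a finite measure. [folklore] -/
theorem levyCT_isFiniteMeasure_withDensity (d : (Fin 3 → ℝ) → ℝ) (hdi : Integrable d) :
    IsFiniteMeasure ((volume : Measure (Fin 3 → ℝ)).withDensity fun y => ENNReal.ofReal (d y)) :=
  isFiniteMeasure_withDensity_ofReal hdi.2

/-- Integration against a measure with a nonnegative measurable density:
`∫ φ d(d · vol) = ∫ d φ`. [folklore] -/
theorem levyCT_integral_withDensity (d : (Fin 3 → ℝ) → ℝ) (hd0 : ∀ y, 0 ≤ d y)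
    (hdm : Measurable d) (φ : (Fin 3 → ℝ) → ℝ) :
    ∫ y, φ y ∂((volume : Measure (Fin 3 → ℝ)).withDensity fun y => ENNReal.ofReal (d y)) =
      ∫ y, d y * φ y := by
  rw [integral_withDensity_eq_integral_toReal_smul₀ hdm.ennreal_ofReal.aemeasurable
    (ae_of_all _ fun _ => ENNReal.ofReal_lt_top)]
  refine integral_congr_ae (ae_of_all _ fun y => ?_)
  simp only [ENNReal.toReal_ofReal (hd0 y), smul_eq_mul]


/-- A measure with a nonnegative integrable density of positive total integral is nonzero.
[folklore] -/
theorem levyCT_withDensity_ne_zero (d : (Fin 3 → ℝ) → ℝ) (hd0 : ∀ y, 0 ≤ d y)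
    (hdi : Integrable d) (hpos : 0 < ∫ y, d y) :
    ((volume : Measure (Fin 3 → ℝ)).withDensity fun y => ENNReal.ofReal (d y)) ≠ 0 := by
  intro h
  have h1 : ((volume : Measure (Fin 3 → ℝ)).withDensity fun y => ENNReal.ofReal (d y))
      Set.univ = 0 := by
    rw [h, Measure.coe_zero, Pi.zero_apply]
  rw [withDensity_apply _ MeasurableSet.univ, Measure.restrict_univ,
    ← ofReal_integral_eq_lintegral_ofReal hdi (ae_of_all _ hd0), ENNReal.ofReal_eq_zero] at h1
  linarith

/-! ### The test function `f / (1 - e^{-|y|₂²/2})` -/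

/-- **Division of a test function by the weight.**  If `f` is continuous with compact support
and vanishes near the origin, then `h = f / (1 - e^{-|y|₂²/2})` is continuous and bounded, and
`(1 - e^{-|y|₂²/2}) h = f`. [folklore] -/
theorem levyCT_test_function (f : (Fin 3 → ℝ) → ℝ) (hf : Continuous f)
    (hfc : HasCompactSupport f) (hf0 : (0 : Fin 3 → ℝ) ∉ tsupport f) :
    ∃ B : ℝ, Continuous (fun y => f y / (1 - Real.exp (-(1 / 2 * ∑ i, y i ^ 2)))) ∧
      (∀ y, |f y / (1 - Real.exp (-(1 / 2 * ∑ i, y i ^ 2)))| ≤ B) ∧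
      ∀ y, (1 - Real.exp (-(1 / 2 * ∑ i, y i ^ 2))) *
        (f y / (1 - Real.exp (-(1 / 2 * ∑ i, y i ^ 2)))) = f y := by
  set g : (Fin 3 → ℝ) → ℝ := fun y => 1 - Real.exp (-(1 / 2 * ∑ i, y i ^ 2)) with hg
  have hgc : Continuous g := by
    simp only [hg]
    fun_prop
  have hg_mono : ∀ y, 1 - Real.exp (-(1 / 2 * ‖y‖ ^ 2)) ≤ g y := by
    intro y
    have hsq : ‖y‖ ^ 2 ≤ ∑ i, y i ^ 2 := by
      have h1 : ‖y‖ ≤ √(∑ i, y i ^ 2) := by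
        refine (pi_norm_le_iff_of_nonneg (Real.sqrt_nonneg _)).2 fun i => ?_
        rw [Real.norm_eq_abs]
        exact Real.abs_le_sqrt
          (Finset.single_le_sum (fun j _ => sq_nonneg (y j)) (Finset.mem_univ i))
      calc ‖y‖ ^ 2 ≤ √(∑ i, y i ^ 2) ^ 2 := pow_le_pow_left₀ (norm_nonneg _) h1 2
        _ = ∑ i, y i ^ 2 := Real.sq_sqrt (Finset.sum_nonneg fun j _ => sq_nonneg _)
    simp only [hg]
    gcongr
  have hg_pos : ∀ y, y ≠ 0 → 0 < g y := by
    intro y hy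
    have hn : 0 < ‖y‖ := norm_pos_iff.2 hy
    have h1 : 0 < 1 - Real.exp (-(1 / 2 * ‖y‖ ^ 2)) := by
      rw [sub_pos, Real.exp_lt_one_iff]
      nlinarith
    exact h1.trans_le (hg_mono y)
  -- `f` vanishes on a ball around the origin
  obtain ⟨δ, hδ, hball⟩ : ∃ δ > 0, Metric.ball (0 : Fin 3 → ℝ) δ ⊆ (tsupport f)ᶜ :=
    Metric.mem_nhds_iff.1 ((isClosed_tsupport f).isOpen_compl.mem_nhds hf0)
  have hf_ball : ∀ y : Fin 3 → ℝ, ‖y‖ < δ → f y = 0 := fun y hy =>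
    image_eq_zero_of_notMem_tsupport (hball (mem_ball_zero_iff.2 hy))
  have hgδ : 0 < 1 - Real.exp (-(1 / 2 * δ ^ 2)) := by
    rw [sub_pos, Real.exp_lt_one_iff]
    nlinarith
  have hg_low : ∀ y, δ ≤ ‖y‖ → 1 - Real.exp (-(1 / 2 * δ ^ 2)) ≤ g y := by
    intro y hy
    refine le_trans ?_ (hg_mono y)
    gcongr
  obtain ⟨Cf, hCf⟩ := hfc.exists_bound_of_continuous hf
  have hCf0 : 0 ≤ Cf := (norm_nonneg _).trans (hCf 0)
  refine ⟨Cf / (1 - Real.exp (-(1 / 2 * δ ^ 2))), ?_, ?_, ?_⟩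
  · rw [continuous_iff_continuousAt]
    intro y₀
    by_cases hy₀ : y₀ = 0
    · subst hy₀
      have hev : (fun y => f y / g y) =ᶠ[𝓝 (0 : Fin 3 → ℝ)] fun _ => 0 := by
        filter_upwards [Metric.ball_mem_nhds (0 : Fin 3 → ℝ) hδ] with y hy
        rw [hf_ball y (mem_ball_zero_iff.1 hy), zero_div]
      exact continuousAt_const.congr_of_eventuallyEq hev
    · exact hf.continuousAt.div hgc.continuousAt (hg_pos y₀ hy₀).ne'
  · intro y
    by_cases hy : ‖y‖ < δ
    · rw [hf_ball y hy, zero_div, abs_zero]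
      positivity
    · push Not at hy
      have hgy := hg_low y hy
      have hgpos : 0 < g y := hgδ.trans_le hgy
      change |f y / g y| ≤ _
      rw [abs_div, abs_of_pos hgpos, div_le_div_iff₀ hgpos hgδ]
      have h1 := hCf y
      rw [Real.norm_eq_abs] at h1
      nlinarith [abs_nonneg (f y)]
  · intro y
    by_cases hy : y = 0
    · subst hy
      rw [hf_ball 0 (by simpa using hδ)]
      simp
    · exact mul_div_cancel₀ _ (hg_pos y hy).ne'

/-- **Registered helper sub-goal `stub_levyContinuityTransfer_auxLevyTransfer`** of stub
`stub_levyContinuityTransfer` (line `diffusive-branch-is-nonsaturation`, crux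
stmt-CriticalPhenomena-4799): Lévy's continuity theorem for finite measures on `ℝ³`, with the
characteristic functions split into cosine and sine transforms. [folklore] -/
theorem stub_levyContinuityTransfer_auxLevyTransfer :
    ∀ (μs : ℕ → MeasureTheory.Measure (Fin 3 → ℝ)) (μ : MeasureTheory.Measure (Fin 3 → ℝ)),
      (∀ n, MeasureTheory.IsFiniteMeasure (μs n)) → MeasureTheory.IsFiniteMeasure μ → μ ≠ 0 →
      (∀ ξ : Fin 3 → ℝ, Filter.Tendsto (fun n => ∫ y, Real.cos (∑ j, ξ j * y j) ∂(μs n))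
        Filter.atTop (nhds (∫ y, Real.cos (∑ j, ξ j * y j) ∂μ))) →
      (∀ ξ : Fin 3 → ℝ, Filter.Tendsto (fun n => ∫ y, Real.sin (∑ j, ξ j * y j) ∂(μs n))
        Filter.atTop (nhds (∫ y, Real.sin (∑ j, ξ j * y j) ∂μ))) →
      ∀ (φ : (Fin 3 → ℝ) → ℝ), Continuous φ → ∀ B : ℝ, (∀ y, |φ y| ≤ B) →
        Filter.Tendsto (fun n => ∫ y, φ y ∂(μs n)) Filter.atTop (nhds (∫ y, φ y ∂μ)) := by
  intro μs μ hfin hfinμ hne hcos hsin φ hφ B hB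
  haveI := hfin
  haveI := hfinμ
  exact levyCT_levy_transfer μs μ hne hcos hsin φ hφ B hB

end Summit.CriticalPhenomena.Ising3DConformalLimit.Cruxes.DirectCorrelationStableTail.DiffusiveBranchIsNonsaturation

end
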